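import Summits.QuantumFields.BalabanUV.Beta.D1BFx.TorusWeightWordTwisted
import Summits.QuantumFields.BalabanUV.Beta.D1BFx.RProjectorJetLeibniz
import Summits.QuantumFields.BalabanUV.Beta.D1BFx.KernelFormOperators
import Summits.QuantumFields.BalabanUV.Beta.D1BFx.GluonNeedleSplit
import Literature.MathematicalPhysics.QuantumFieldTheory.Balaban1983to89.Beta.KernelReflection

/-!
# `BalabanUV.Beta.D1BFx.CoframeJetProjection` — road «BF-x» for binder row D1, slot (K), BINDER (C1) «TB4-W CO-FRAME FIRST JET»,
# brick **«COFRAME-JET-PROJECTION»** (ruling ρ-g19-3, journal l.43441): THE COMBINED SITE WORD OF THE CO-FRAME FIRST WEIGHT JET IS A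
# PROJECTOR SANDWICH — on `ℤ⁴`, `L̂∘Ĉ∘L̂ = R` EXACTLY (`R = 1 − P`, `RJetProjector.Rgt`), `wC = wR∘R + R∘wL`, hence
# **`wL + wR − wC = P∘wL + wR∘P`** (`P = RProjector.Pgt`) `= n²•(P∘ghCur∘G′∘R + R∘G′∘ghCur∘P) = n²•rdotOf G′ P ghCur 0`, antisymmetric;
# and the END's twisted bond kernel reads `tBw₁ = 2•(dSw (P∘wL + wR∘P) + jetR κ u R − jetC κ u R)`

HONEST DEPENDENCY (cell records, verbatim): «continuum YM on T⁴ ⇐ BetaPertH ∧ nine spine estimates (0/9 proved); BetaPertH ⇐ (D1) ∧ (D4) ∧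
CAP+tail; G-an2-4 gates asym, D1 and NE2/3/4.»  HONEST FRAMING (cell contract, verbatim): «discharging `BetaPertH` makes Bałaban's UV stability
UNCONDITIONAL — a real constructive-QFT result; it is NOT the continuum limit and NOT the Clay problem.»  THIS MODULE DISCHARGES NOTHING of (K),
of D1 or of the wall: [folklore] absolutely convergent `comp` algebra over LANDED objects — `TorusWeightWordArrays.wL ∕ wR ∕ wC`,
`TorusWeightWordTwisted.tBw₁`, `KGhostLeg.Cgh = n⁴·G′∘R∘G′`, `GhostLeg.Ggh` with `TowerEquationForms.tsum_lapKer_mul_Ggh` (`(n²(−Δ) + a n⁻⁴·1_{blk})·G′ = 𝟙`),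
`RProjector.Pgt`∕`RJetProjector.Rgt` with `RProjectorRange.tsum_gq_mul_Pgt` (`Q′G′·P = Q′G′`) and `RProjectorJetLeibniz.trK_Pgt`,
`TameKernelCalculus` (associativity ∕ distributivity for tame factors), `RProjectorJet.rdotOf` — BY NAME.  No `def`, no `def … : Prop`, nothing
cited, 0 sorry.  It proves NO mass row: whether the sandwich `P∘wL + wR∘P` has m-uniform centred mass is the COUNT (gan24-leaf-05's (γ)∕(δ)
currency), not asserted here.  0∕4 binders of row D1; (C1)(C2) OPEN; (K) NOT closed; NOT D1, NOT BetaPertH, NOT continuum, NOT Clay.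

ABSOLUTE RULE (cell charter, verbatim): «No internally-minted statement may enter as a cited fact. Every hypothesis is either kernel-proved in this
package or a verbatim quotation of a PUBLISHED theorem with page reference. The manuscript(s) under audit are NOT citable for their own disputed
steps — they are the thing under adjudication; programme-internal (2001/route/tribunal) claims are never citable.»

WHAT AND WHY.  The END of road «BF-x» carries the co-frame first weight jet of one bond `⟨u, u + e_κ⟩` as the `ℤ⁴` kernel
`tBw₁ n a κ u = 2•(dSw wL + jetR κ u Rgt − dSw wC + dSw wR − jetC κ u Rgt)` (`TorusWeightWordTwisted`, the TWISTED jet; the straight `Bw₁` of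
`TorusWeightWordArrays` re-signs the `wL`∕`jetR` letters).  Word by word the site letters `wL = ghCur∘(Ĉ∘L̂)`, `wR = (L̂∘Ĉ)∘ghCur`,
`wC = (L̂∘Ĉ)∘(ghCur∘L̂ + L̂∘ghCur)∘(Ĉ∘L̂)` have centred mass `≍ n²` (`Ĉ∘L̂ = n²·G′∘R`, §2), so the (C1) row cannot be counted as a sum of word
masses (ruling ρ-g19-3 (1)).  The combined site word `wL + wR − wC` is the bond jet of the PROJECTOR `R = L̂∘Ĉ∘L̂` (`Ĉ_s = −Ĉ(L̂²)_sĈ`), and a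
projector's jet lives in the off-diagonal corners: `Ṙ = P∘Ṙ∘R + R∘Ṙ∘P`.  §2 proves the `ℤ⁴` identity `L̂∘Ĉ∘L̂ = R` (torus twin:
`TorusBondArrays.Lhat_Chat_Lhat_eq_perT`) from the tower equation and `Q′G′R = 0`; §3 the word identities; §4 the junction with J5's generic
stripped jet `rdotOf` (`V := ghCur`, NO averaging corner: `J := 0`) and the antisymmetry; §5 the END's kernel in sandwich form.

CONTENT (all [folklore]; `n ≥ 1` the block side, `a > 0`):
* §1 letters: `spr_lapU`, `spr_Cgh`, `loc_ghCur`, `trK_lapU`, `trK_Rgt`, `Cgh_eq_smul`, `trK_Cgh`, `trK_ghCur`, `Pgt_eq_idK_sub`.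
* §2 **`comp_lapU_Ggh_apply`** (`(L̂∘G′)(p,q) = n⁻²(δ_{pq} − a n⁻⁴·(G′Q′*)(q, blk p))`), **`comp_lapU_Ggh_Rgt`** (`L̂∘G′∘R = n⁻²•R`),
  **`comp_lapU_Cgh`** (`L̂∘Ĉ = n²•R∘G′`), **`comp_Cgh_lapU`** (`Ĉ∘L̂ = n²•G′∘R`), **`comp_lapU_Cgh_lapU`** (`L̂∘Ĉ∘L̂ = R`).
* §3 `wR_eq`, `wL_eq` (`wR = n²•(R∘G′)∘ghCur`, `wL = n²•ghCur∘(G′∘R)`), `trK_wR`, `trK_wL`, **`wC_eq_sandwich`** (`wC = wR∘R + R∘wL`),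
  **`coframeJet_eq`** (`wL + wR − wC = P∘wL + wR∘P`), `coframeJet_eq_legs`, `straightJet_eq` (`−wL + wR − wC = P∘wL + wR∘P − 2•wL`).
* §4 `RG_Ggh_Pgt`, **`coframeJet_eq_rdotOf`** (`wL + wR − wC = n²•rdotOf (Ggh n a) (Pgt n a) (ghCur κ u) 0`), **`trK_coframeJet`** (antisymmetry).
* §5 **`tBw₁_eq_projection`**: `tBw₁ n a κ u = 2•(dSw (P∘wL + wR∘P) + jetR κ u R − jetC κ u R)`.
Unit `b2b-balaban-beta-d1-formalise-leaf-03` (gen 24); road owner `b2b-balaban-beta-d1-p2` (ρ-g19-1 amended l.43347, ρ-g19-3 l.43441).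
-/

noncomputable section

namespace Summit.QuantumFields.BalabanUV.Beta.D1BFx.CoframeJetProjection

open Literature.MathematicalPhysics.QuantumFieldTheory.Balaban1983to89
open Literature.MathematicalPhysics.QuantumFieldTheory.Balaban1983to89.Beta
open ExpKernelCalculus (MKer Decays BiLoc comp)
open HessKerSchurResolvent (idK idK_apply comp_idK_left comp_idK_right)
open B6QGQLower276 (B lapKer lapKer_symm)
open B5Hk103ScalarZd (Gk gq)
open Summit.QuantumFields.BalabanUV.Beta.TameKernelCalculus (Tame Spr Loc trK trK_apply trK_comp trK_trK trK_add trK_neg spr_idK comp_assoc_tame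
  comp_sub_left_tame comp_sub_right_tame comp_add_left_tame comp_add_right_tame comp_neg_left comp_neg_right)
open KernelReflection (comp_smul_right)
open Summit.QuantumFields.BalabanUV.Beta.D1BFx.GhostStencil (ghCur ghCur_apply biLoc_ghCur)
open Summit.QuantumFields.BalabanUV.Beta.D1BFx.GhostLeg (Ggh Ggh_apply trK_Ggh tame_Ggh spr_Ggh)
open Summit.QuantumFields.BalabanUV.Beta.D1BFx.RProjector (Pgt Pgt_apply)
open Summit.QuantumFields.BalabanUV.Beta.D1BFx.RProjectorRange (Gk_symm summable_gq_mul_Pker tsum_gq_mul_Pgt)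
open Summit.QuantumFields.BalabanUV.Beta.D1BFx.RJetProjector (Rgt Rgt_apply Rgt_symm)
open Summit.QuantumFields.BalabanUV.Beta.D1BFx.RProjectorJet (RG cornerV cornerJ rdotOf rdotOf_def)
open Summit.QuantumFields.BalabanUV.Beta.D1BFx.RProjectorJetLeibniz (spr_comp trK_Pgt)
open Summit.QuantumFields.BalabanUV.Beta.D1BFx.LandauMultiplierMean (spr_Pgt sum_blk_Ggh)
open Summit.QuantumFields.BalabanUV.Beta.D1BFx.KernelFormOperators (spr_Rgt)
open Summit.QuantumFields.BalabanUV.Beta.D1BFx.KGhostLeg (Cgh Cgh_apply decays_Cgh deltaCgh_pos)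
open Summit.QuantumFields.BalabanUV.Beta.D1BFx.TorusGhostWordArrays (lapU lapU_apply decays_lapU Lgh)
open Summit.QuantumFields.BalabanUV.Beta.D1BFx.TowerEquationForms (tsum_lapKer_mul_Ggh)
open Summit.QuantumFields.BalabanUV.Beta.D1BFx.TorusWeightWordArrays (wL wR wC)
open Summit.QuantumFields.BalabanUV.Beta.D1BFx.TorusWeightWordTwisted (tBw₁)
open Summit.QuantumFields.BalabanUV.Beta.D1BFx.TorusJetSandwichArrays (jetR jetC)
open Summit.QuantumFields.BalabanUV.Beta.D1BFx.RJetAssembly (dSw)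
open Summit.QuantumFields.BalabanUV.Beta.D1BFx.GluonNeedleSplit (dSw_add dSw_sub)

variable (n : ℕ) [NeZero n] (a : ℝ)

/-! ## §1 Letters: spread ∕ localised factors and transposes -/

/-- [folklore] The unit Laplacian row kernel `lapU` is spread (`decays_lapU`). -/
theorem spr_lapU : Spr lapU := ⟨_, 1, one_pos, decays_lapU⟩

/-- [folklore] The ghost propagator leg `Ĉ = Cgh n a` is spread (`decays_Cgh`). -/
theorem spr_Cgh (ha : 0 < a) : Spr (Cgh n a) := by
  obtain ⟨C, hC⟩ := decays_Cgh n a ha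
  exact ⟨C, _, deltaCgh_pos n a ha, hC⟩

omit [NeZero n] in
/-- [folklore] The ghost current of a bond is localised at the bond (`biLoc_ghCur`). -/
theorem loc_ghCur (κ : Fin 4) (u : (Fin 4 → ℤ)) : Loc (ghCur κ u) := ⟨u, u, _, 1, one_pos, biLoc_ghCur κ u 1⟩

/-- [folklore] `lapU` is symmetric: `trK lapU = lapU`. -/
theorem trK_lapU : trK lapU = lapU := by
  funext x y v w
  rw [trK_apply, lapU_apply, lapU_apply, lapKer_symm]

omit [NeZero n] in
/-- [folklore] `R = 1 − P` is symmetric: `trK (Rgt n a) = Rgt n a` (`Rgt_symm`). -/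
theorem trK_Rgt (ha : 0 < a) : trK (Rgt n a) = Rgt n a := by
  funext x y v w
  cases v; cases w
  rw [trK_apply]
  exact Rgt_symm n a ha x y

omit [NeZero n] in
/-- [folklore] `P` in `1 − R` form: `Pgt n a = idK − Rgt n a`. -/
theorem Pgt_eq_idK_sub : Pgt n a = idK - Rgt n a := by
  funext x y v w
  cases v; cases w
  simp only [Pi.sub_apply, idK_apply, Rgt_apply, and_true, sub_sub_cancel]

/-- [our object, unfolded] `Ĉ = n⁴ • G′∘(R∘G′)` as a kernel (`KGhostLeg.Cgh_apply`). -/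
theorem Cgh_eq_smul : Cgh n a = ((n : ℝ) ^ 4) • comp (Ggh n a) (comp (Rgt n a) (Ggh n a)) := by
  funext x y v w
  rw [Cgh_apply]
  rfl

/-- [folklore] `Ĉ` is symmetric: `trK (Cgh n a) = Cgh n a`. -/
theorem trK_Cgh (ha : 0 < a) : trK (Cgh n a) = Cgh n a := by
  have hG := tame_Ggh n a ha
  have hR := (spr_Rgt n a ha).tame
  have e : trK (((n : ℝ) ^ 4) • comp (Ggh n a) (comp (Rgt n a) (Ggh n a)))
      = ((n : ℝ) ^ 4) • trK (comp (Ggh n a) (comp (Rgt n a) (Ggh n a))) := rfl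
  rw [Cgh_eq_smul, e, trK_comp, trK_comp, trK_Ggh n a ha, trK_Rgt n a ha, ← comp_assoc_tame hG hR hG]

/-- [folklore] The ghost current is antisymmetric: `trK (ghCur κ u) = −ghCur κ u`. -/
theorem trK_ghCur (κ : Fin 4) (u : (Fin 4 → ℤ)) : trK (ghCur κ u) = -ghCur κ u := by
  funext x z v w
  show ghCur κ u z x w v = -(ghCur κ u x z v w)
  rw [ghCur_apply, ghCur_apply, neg_sub]
  congr 1
  · exact if_congr and_comm rfl rfl
  · exact if_congr and_comm rfl rfl

/-! ## §2 The `ℤ⁴` projector identity `L̂∘Ĉ∘L̂ = R` -/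

/-- [folklore] **THE LAPLACIAN ROW OF THE LEG**: `(L̂∘G′)(p,q) = n⁻²·(δ_{pq} − a·n⁻⁴·(G′Q′*)(q, blk p))` (`tsum_lapKer_mul_Ggh`, `G′` symmetric). -/
theorem comp_lapU_Ggh_apply (ha : 0 < a) (p q : (Fin 4 → ℤ)) (v w : Unit) :
    comp lapU (Ggh n a) p q v w
      = ((n : ℝ) ^ 2)⁻¹ * ((if p = q then 1 else 0) - a / (n : ℝ) ^ 4 * gq (d := 4) (n - 1) a q (B6QGQLower276.blk (n - 1) p)) := by
  cases v; cases w
  simp only [comp, Finset.univ_unique, PUnit.default_eq_unit, Finset.sum_singleton, lapU_apply]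
  rw [tsum_lapKer_mul_Ggh n a ha p q]
  have hS : ∑ r ∈ B (n - 1) (B6QGQLower276.blk (n - 1) p), Ggh n a r q () () = gq (d := 4) (n - 1) a q (B6QGQLower276.blk (n - 1) p) := by
    rw [← sum_blk_Ggh n a q (B6QGQLower276.blk (n - 1) p) () ()]
    exact Finset.sum_congr rfl fun r _ => by rw [Ggh_apply, Ggh_apply, Gk_symm (n - 1) ha r q]
  rw [hS]

/-- [folklore] **`L̂∘G′∘R = n⁻²•R`**: the `aQ′*Q′`-part of the tower equation dies against `R` because `Q′G′·P = Q′G′` (`tsum_gq_mul_Pgt`). -/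
theorem comp_lapU_Ggh_Rgt (ha : 0 < a) : comp (comp lapU (Ggh n a)) (Rgt n a) = ((n : ℝ) ^ 2)⁻¹ • Rgt n a := by
  classical
  funext p z v w
  cases v; cases w
  have eo : comp (comp lapU (Ggh n a)) (Rgt n a) p z () () = ∑' y : (Fin 4 → ℤ), comp lapU (Ggh n a) p y () () * Rgt n a y z () () := by
    simp only [comp, Finset.univ_unique, PUnit.default_eq_unit, Finset.sum_singleton]
  rw [eo, Pi.smul_apply, Pi.smul_apply, Pi.smul_apply, Pi.smul_apply, smul_eq_mul]
  simp only [comp_lapU_Ggh_apply n a ha]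
  -- the Kronecker part
  have hs1 : Summable fun y : (Fin 4 → ℤ) => (if p = y then (1 : ℝ) else 0) * Rgt n a y z () () := by
    refine summable_of_ne_finset_zero (s := {p}) fun y hy => ?_
    rw [Finset.mem_singleton] at hy
    rw [if_neg (Ne.symm hy), zero_mul]
  have h1 : ∑' y : (Fin 4 → ℤ), (if p = y then (1 : ℝ) else 0) * Rgt n a y z () () = Rgt n a p z () () := by
    rw [tsum_eq_single p (fun y hy => by rw [if_neg (Ne.symm hy), zero_mul]), if_pos rfl, one_mul]
  -- the block part: `Σ'_y (G′Q′*)(y, (B6QGQLower276.blk (n - 1) p))·R(y, z) = (G′Q′*)(z, (B6QGQLower276.blk (n - 1) p)) − (G′Q′*)(z, (B6QGQLower276.blk (n - 1) p)) = 0`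
  have hs2a : Summable fun y : (Fin 4 → ℤ) => gq (d := 4) (n - 1) a y (B6QGQLower276.blk (n - 1) p) * (if y = z then (1 : ℝ) else 0) := by
    refine summable_of_ne_finset_zero (s := {z}) fun y hy => ?_
    rw [Finset.mem_singleton] at hy
    rw [if_neg hy, mul_zero]
  have hs2b : Summable fun y : (Fin 4 → ℤ) => gq (d := 4) (n - 1) a y (B6QGQLower276.blk (n - 1) p) * Pgt n a y z () () := by
    simp only [Pgt_apply]
    exact summable_gq_mul_Pker (n - 1) ha (B6QGQLower276.blk (n - 1) p) z
  have e2 : ∀ y : (Fin 4 → ℤ), gq (d := 4) (n - 1) a y (B6QGQLower276.blk (n - 1) p) * Rgt n a y z () ()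
      = gq (d := 4) (n - 1) a y (B6QGQLower276.blk (n - 1) p) * (if y = z then (1 : ℝ) else 0) - gq (d := 4) (n - 1) a y (B6QGQLower276.blk (n - 1) p) * Pgt n a y z () () := by
    intro y; rw [Rgt_apply]; ring
  have hs2 : Summable fun y : (Fin 4 → ℤ) => gq (d := 4) (n - 1) a y (B6QGQLower276.blk (n - 1) p) * Rgt n a y z () () := by
    simp only [e2]; exact hs2a.sub hs2b
  have h2 : ∑' y : (Fin 4 → ℤ), gq (d := 4) (n - 1) a y (B6QGQLower276.blk (n - 1) p) * Rgt n a y z () () = 0 := by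
    simp only [e2]
    rw [hs2a.tsum_sub hs2b, tsum_eq_single z (fun y hy => by rw [if_neg hy, mul_zero]), if_pos rfl, mul_one,
      tsum_gq_mul_Pgt n ha (B6QGQLower276.blk (n - 1) p) z (), sub_self]
  have e3 : ∀ y : (Fin 4 → ℤ), ((n : ℝ) ^ 2)⁻¹ * ((if p = y then 1 else 0) - a / (n : ℝ) ^ 4 * gq (d := 4) (n - 1) a y (B6QGQLower276.blk (n - 1) p)) * Rgt n a y z () ()
      = ((n : ℝ) ^ 2)⁻¹ * ((if p = y then (1 : ℝ) else 0) * Rgt n a y z () ())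
        - ((n : ℝ) ^ 2)⁻¹ * (a / (n : ℝ) ^ 4) * (gq (d := 4) (n - 1) a y (B6QGQLower276.blk (n - 1) p) * Rgt n a y z () ()) := by
    intro y; ring
  simp only [e3]
  rw [(hs1.mul_left _).tsum_sub (hs2.mul_left _), tsum_mul_left, tsum_mul_left, h1, h2, mul_zero, sub_zero]

/-- [folklore] **`L̂∘Ĉ = n²•R∘G′`.** -/
theorem comp_lapU_Cgh (ha : 0 < a) : comp lapU (Cgh n a) = ((n : ℝ) ^ 2) • comp (Rgt n a) (Ggh n a) := by
  have hL := (spr_lapU).tame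
  have hG := tame_Ggh n a ha
  have hR := (spr_Rgt n a ha).tame
  have hRG : Tame (comp (Rgt n a) (Ggh n a)) := (spr_comp (spr_Rgt n a ha) (spr_Ggh n a ha)).tame
  have hLG : Tame (comp lapU (Ggh n a)) := (spr_comp spr_lapU (spr_Ggh n a ha)).tame
  have hn : (n : ℝ) ≠ 0 := by exact_mod_cast NeZero.ne n
  rw [Cgh_eq_smul, comp_smul_right, comp_assoc_tame hL hG hRG, comp_assoc_tame hLG hR hG, comp_lapU_Ggh_Rgt n a ha, KernelReflection.comp_smul_left,
    smul_smul]
  congr 1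
  field_simp

/-- [folklore] **`Ĉ∘L̂ = n²•G′∘R`** (transpose of `comp_lapU_Cgh`). -/
theorem comp_Cgh_lapU (ha : 0 < a) : comp (Cgh n a) lapU = ((n : ℝ) ^ 2) • comp (Ggh n a) (Rgt n a) := by
  have h := congrArg trK (comp_lapU_Cgh n a ha)
  rw [trK_comp, trK_lapU, trK_Cgh n a ha] at h
  have e : trK (((n : ℝ) ^ 2) • comp (Rgt n a) (Ggh n a)) = ((n : ℝ) ^ 2) • trK (comp (Rgt n a) (Ggh n a)) := rfl
  rw [h, e, trK_comp, trK_Ggh n a ha, trK_Rgt n a ha]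

/-- [folklore] **THE `ℤ⁴` PROJECTOR IDENTITY `L̂∘Ĉ∘L̂ = R`** (`R = 1 − P`; torus twin `TorusBondArrays.Lhat_Chat_Lhat_eq_perT`). -/
theorem comp_lapU_Cgh_lapU (ha : 0 < a) : comp (comp lapU (Cgh n a)) lapU = Rgt n a := by
  have hL := (spr_lapU).tame
  have hG := tame_Ggh n a ha
  have hR := (spr_Rgt n a ha).tame
  have hn : (n : ℝ) ≠ 0 := by exact_mod_cast NeZero.ne n
  have h := congrArg trK (comp_lapU_Ggh_Rgt n a ha)
  rw [trK_comp, trK_comp, trK_lapU, trK_Ggh n a ha, trK_Rgt n a ha] at h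
  have e : trK (((n : ℝ) ^ 2)⁻¹ • Rgt n a) = ((n : ℝ) ^ 2)⁻¹ • trK (Rgt n a) := rfl
  rw [e, trK_Rgt n a ha] at h
  rw [comp_lapU_Cgh n a ha, KernelReflection.comp_smul_left, ← comp_assoc_tame hR hG hL, h, smul_smul, mul_inv_cancel₀ (pow_ne_zero 2 hn), one_smul]

/-! ## §3 The word identities -/

section Words

variable (κ : Fin 4) (u : (Fin 4 → ℤ))

/-- [folklore] **`wR = n²•(R∘G′)∘ghCur`.** -/
theorem wR_eq (ha : 0 < a) : wR n a κ u = ((n : ℝ) ^ 2) • comp (comp (Rgt n a) (Ggh n a)) (ghCur κ u) := by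
  show comp (comp lapU (Cgh n a)) (ghCur κ u) = _
  rw [comp_lapU_Cgh n a ha, KernelReflection.comp_smul_left]

/-- [folklore] **`wL = n²•ghCur∘(G′∘R)`.** -/
theorem wL_eq (ha : 0 < a) : wL n a κ u = ((n : ℝ) ^ 2) • comp (ghCur κ u) (comp (Ggh n a) (Rgt n a)) := by
  show comp (ghCur κ u) (comp (Cgh n a) lapU) = _
  rw [comp_Cgh_lapU n a ha, comp_smul_right]

/-- [folklore] `trK wR = −wL` (the ghost current is antisymmetric, the legs symmetric). -/
theorem trK_wR (ha : 0 < a) : trK (wR n a κ u) = -wL n a κ u := by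
  show trK (comp (comp lapU (Cgh n a)) (ghCur κ u)) = -comp (ghCur κ u) (comp (Cgh n a) lapU)
  rw [trK_comp, trK_comp, trK_ghCur, trK_lapU, trK_Cgh n a ha, comp_neg_left]

/-- [folklore] `trK wL = −wR`. -/
theorem trK_wL (ha : 0 < a) : trK (wL n a κ u) = -wR n a κ u := by
  show trK (comp (ghCur κ u) (comp (Cgh n a) lapU)) = -comp (comp lapU (Cgh n a)) (ghCur κ u)
  rw [trK_comp, trK_comp, trK_ghCur, trK_lapU, trK_Cgh n a ha, comp_neg_right]

/-- [folklore] **`wC = wR∘R + R∘wL`** — associativity of `comp` for tame factors and `L̂∘Ĉ∘L̂ = R`: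
`(L̂Ĉ)(ghCur L̂ + L̂ ghCur)(ĈL̂) = (L̂Ĉ ghCur)(L̂ĈL̂) + (L̂ĈL̂)(ghCur ĈL̂)`. -/
theorem wC_eq_sandwich (ha : 0 < a) : wC n a κ u = comp (wR n a κ u) (Rgt n a) + comp (Rgt n a) (wL n a κ u) := by
  have sL := spr_lapU
  have sC := spr_Cgh n a ha
  have lg := loc_ghCur κ u
  have hL := sL.tame
  have hC := sC.tame
  have hg := lg.tame
  have hLC : Tame (comp lapU (Cgh n a)) := (spr_comp sL sC).tame
  have hCL : Tame (comp (Cgh n a) lapU) := (spr_comp sC sL).tame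
  have hgL : Tame (comp (ghCur κ u) lapU) := (lg.comp_spr sL).tame
  have hLg : Tame (comp lapU (ghCur κ u)) := (sL.comp_loc lg).tame
  have hLCg : Tame (comp (comp lapU (Cgh n a)) (ghCur κ u)) := ((spr_comp sL sC).comp_loc lg).tame
  have hLCL : Tame (comp (comp lapU (Cgh n a)) lapU) := (spr_comp (spr_comp sL sC) sL).tame
  have hLCgL : Tame (comp (comp lapU (Cgh n a)) (comp (ghCur κ u) lapU)) := ((spr_comp sL sC).comp_loc (lg.comp_spr sL)).tame
  have hLCLg : Tame (comp (comp lapU (Cgh n a)) (comp lapU (ghCur κ u))) := ((spr_comp sL sC).comp_loc (sL.comp_loc lg)).tame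
  rw [← comp_lapU_Cgh_lapU n a ha]
  show comp (comp (comp lapU (Cgh n a)) (comp (ghCur κ u) lapU + comp lapU (ghCur κ u))) (comp (Cgh n a) lapU)
    = comp (comp (comp lapU (Cgh n a)) (ghCur κ u)) (comp (comp lapU (Cgh n a)) lapU)
      + comp (comp (comp lapU (Cgh n a)) lapU) (comp (ghCur κ u) (comp (Cgh n a) lapU))
  rw [comp_add_right_tame hLC hgL hLg, comp_add_left_tame hLCgL hLCLg hCL]
  congr 1
  · rw [comp_assoc_tame hLC hg hL, ← comp_assoc_tame hLCg hL hCL, comp_assoc_tame hL hC hL]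
  · rw [comp_assoc_tame hLC hL hg, ← comp_assoc_tame hLCL hg hCL]

/-- [folklore] **«COFRAME-JET-PROJECTION»: `wL + wR − wC = P∘wL + wR∘P`** — the combined site word of the twisted co-frame first jet is the
off-diagonal projector sandwich of its two one-leg words (`P = 1 − R = Pgt n a`). -/
theorem coframeJet_eq (ha : 0 < a) :
    wL n a κ u + wR n a κ u - wC n a κ u = comp (Pgt n a) (wL n a κ u) + comp (wR n a κ u) (Pgt n a) := by
  have sL := spr_lapU
  have sC := spr_Cgh n a ha
  have lg := loc_ghCur κ u
  have hR := (spr_Rgt n a ha).tame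
  have hI : Tame (idK : MKer 4 Unit) := (spr_idK).tame
  have hwL : Tame (wL n a κ u) := (lg.comp_spr (spr_comp sC sL)).tame
  have hwR : Tame (wR n a κ u) := ((spr_comp sL sC).comp_loc lg).tame
  rw [wC_eq_sandwich n a κ u ha, Pgt_eq_idK_sub, comp_sub_left_tame hI hR hwL, comp_idK_left, comp_sub_right_tame hwR hI hR,
    comp_idK_right]
  abel

/-- [folklore] **THE SANDWICH ON THE LEGS**: `wL + wR − wC = n²•(P∘(ghCur∘(G′∘R)) + ((R∘G′)∘ghCur)∘P)`. -/
theorem coframeJet_eq_legs (ha : 0 < a) :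
    wL n a κ u + wR n a κ u - wC n a κ u
      = ((n : ℝ) ^ 2) • (comp (Pgt n a) (comp (ghCur κ u) (comp (Ggh n a) (Rgt n a)))
          + comp (comp (comp (Rgt n a) (Ggh n a)) (ghCur κ u)) (Pgt n a)) := by
  rw [coframeJet_eq n a κ u ha, wL_eq n a κ u ha, wR_eq n a κ u ha, comp_smul_right, KernelReflection.comp_smul_left, smul_add]

/-- [folklore] The STRAIGHT combination (`TorusWeightWordArrays.Bw₁`'s letters): `−wL + wR − wC = P∘wL + wR∘P − 2•wL`. -/
theorem straightJet_eq (ha : 0 < a) :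
    -wL n a κ u + wR n a κ u - wC n a κ u = comp (Pgt n a) (wL n a κ u) + comp (wR n a κ u) (Pgt n a) - (2 : ℝ) • wL n a κ u := by
  rw [← coframeJet_eq n a κ u ha, two_smul]
  abel

/-! ## §4 Junction with J5's generic stripped jet and antisymmetry -/

/-- [folklore] `RG G′ P = R∘G′` (`RProjectorJet.RG G P = G − P∘G`, `R = idK − P`). -/
theorem RG_Ggh_Pgt (ha : 0 < a) : RG (Ggh n a) (Pgt n a) = comp (Rgt n a) (Ggh n a) := by
  have hG := tame_Ggh n a ha
  have hP := (spr_Pgt n a ha).tame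
  have hI : Tame (idK : MKer 4 Unit) := (spr_idK).tame
  have e : Rgt n a = idK - Pgt n a := by rw [Pgt_eq_idK_sub, sub_sub_cancel]
  rw [RG, e, comp_sub_left_tame hI hP hG, comp_idK_left]

/-- [folklore] **JUNCTION WITH J5**: `wL + wR − wC = n²•rdotOf (Ggh n a) (Pgt n a) (ghCur κ u) 0` — the co-frame site word is `n²` times
`RProjectorJet`'s generic stripped jet with `V := ghCur κ u` and NO averaging corner (`J := 0`). -/
theorem coframeJet_eq_rdotOf (ha : 0 < a) :
    wL n a κ u + wR n a κ u - wC n a κ u = ((n : ℝ) ^ 2) • rdotOf (Ggh n a) (Pgt n a) (ghCur κ u) 0 := by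
  rw [rdotOf_def, cornerJ, RProjectorJetLeibniz.comp_zero, RProjectorJetLeibniz.trK_zero, sub_zero, sub_zero, cornerV, RG_Ggh_Pgt n a ha,
    trK_comp, trK_comp, trK_comp, trK_Pgt n a ha, trK_ghCur, trK_Ggh n a ha, trK_Rgt n a ha, comp_neg_left, comp_neg_right, sub_neg_eq_add,
    coframeJet_eq_legs n a κ u ha]
  congr 1
  exact add_comm _ _

/-- [folklore] **ANTISYMMETRY**: `trK (wL + wR − wC) = −(wL + wR − wC)`. -/
theorem trK_coframeJet (ha : 0 < a) :
    trK (wL n a κ u + wR n a κ u - wC n a κ u) = -(wL n a κ u + wR n a κ u - wC n a κ u) := by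
  rw [coframeJet_eq n a κ u ha, trK_add, trK_comp, trK_comp, trK_Pgt n a ha, trK_wL n a κ u ha, trK_wR n a κ u ha, comp_neg_left,
    comp_neg_right, neg_add, add_comm]

/-! ## §5 The END's twisted bond kernel in sandwich form -/

/-- [folklore] **`tBw₁ n a κ u = 2•(dSw (P∘wL + wR∘P) + jetR κ u R − jetC κ u R)`** — the three `dSw` letters of `TorusWeightWordTwisted.tBw₁`
combine into ONE `dSw` of the projector sandwich. -/
theorem tBw₁_eq_projection (ha : 0 < a) :
    tBw₁ n a κ u = (2 : ℝ) • (dSw (comp (Pgt n a) (wL n a κ u) + comp (wR n a κ u) (Pgt n a))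
      + jetR κ u (Rgt n a) - jetC κ u (Rgt n a)) := by
  rw [← coframeJet_eq n a κ u ha, dSw_sub, dSw_add]
  show (2 : ℝ) • (dSw (wL n a κ u) + jetR κ u (Rgt n a) - dSw (wC n a κ u) + dSw (wR n a κ u) - jetC κ u (Rgt n a)) = _
  congr 1
  abel

end Words

end Summit.QuantumFields.BalabanUV.Beta.D1BFx.CoframeJetProjection

end
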